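import Mathlib.GroupTheory.Commutator.Basic
import Mathlib.GroupTheory.QuotientGroup.Basic
import Mathlib.Algebra.Group.End
import Mathlib.SetTheory.Cardinal.Finite
import HarnessLib

/-!
# [EtTh] §5: the theta subquotients `(l·Δ_Θ)_D` — group-theoretic core

Mochizuki, *The étale theta function and its Frobenioid-theoretic manifestations*, Publ. RIMS **45**
(2009), §5 p. 327 (PDF p. 101) [cite: MochizukiEtTh2009, §5 p.327 (PDF p.101)]: "recall the
characteristic [cf. Propositions 2.4, 2.6] subquotients `Π^tp_X ↠ (Π^tp_X)^Θ`; `l·Δ_Θ ⊆ (Π^tp_X)^Θ` ….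
Thus, for `D ∈ Ob(D)`, these subquotients determine subquotients `Aut_D(D) ↠ Aut^Θ_D(D)`;
`(l·Δ_Θ)_D ⊆ Aut^Θ_D(D)` which are preserved by arbitrary self-equivalences of `D`", used in Def. 5.4 (b)
and transported, in the proof of Prop. 5.5 (p. 328), along linear morphisms `S'' → S`, which "induce
isomorphisms `(l·Δ_Θ)_{S''} ⊗ ℤ/Nℤ ⥲ (l·Δ_Θ)_S ⊗ ℤ/Nℤ`".  abc-iut cell, layer L2, seat abc-iut-L2-t9 (unit
W2-L2-05, merge adapter: the real instance of abc-iut-L2-t4's `ThetaSubquotientStub`; reading **R2**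
chosen by the §5 owner abc-iut-L2-t4, INBOX 2026-08-25T23:12:55Z).

Write `q : Π ↠ Q := (Π^tp_X)^Θ` for the characteristic quotient and `ι : Λ ↪ Q` for the inclusion of the
abelian group `Λ := l·Δ_Θ` (`L := ι(Λ)` is normal in `Q`: `Δ_Θ ≅ Ẑ(1)` is characteristic in
`Δ^Θ_X ⊲ Π^Θ_X`, p. 238; we carry `Λ` as an abstract abelian group with a homomorphism `ι`
to `Q`).  A connected object `D` of `B^temp(Π)⁰` is a
transitive `Π`-set; at a point `x ∈ D` with (open) stabiliser `S = Stab(x)` the §5 subquotient is the image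
of `N_Π(S) ∩ q⁻¹(L)` in `N_Q(q S)/q(S)`, a subquotient of `Aut_D(D) ≅ N_Π(S)/S`.  This file is the group
theory of the CANONICAL RECEPTACLE of that subquotient, `Λ / ι⁻¹J(S)` with

  `J(S) := (q(S) ∩ L) · [L, q(S)]`  (`killQ`, `kill`),

a quotient OF `Λ` depending only on `S`, monotone in `S` (`killQ_mono`), conjugation-equivariant
(`conj_mem_killQ`), on which `q(S)` acts trivially by conjugation (`conj_mul_inv_mem_killQ` — the reason for
the commutator term: it makes push-forward to NON-Galois objects well defined), and which for `q(S)`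
NORMAL (Galois objects `Π/N`, `q` surjective) is exactly print's `L·q(N)/q(N) ≅ L/(L ∩ q(N))`
(`killQ_eq_of_normal`): the commutator term is then absorbed.  The transport maps between these carriers
(`proj`, along `S ≤ S'`) are surjective (`proj_surjective`), and a surjection of finite groups of equal
order "`⊗ ℤ/Nℤ`" is an isomorphism (`modPowMap_bijective_of_card_eq`) — the shape of print's "induce
isomorphisms … `⊗ ℤ/Nℤ`" under Def. 5.4 (b).  The `B^temp(Π)⁰`-indexed functor built from these carriers is
in `ThetaSubquotientOfTempered.lean`.

HONEST FRAMING: pure group theory; at non-Galois stabilisers `L/J(S)` is an ENLARGEMENT (quotient) of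
print's subquotient-of-`Aut`, receiving it by a canonical homomorphism that is an isomorphism iff the object
is Galois (next file); nothing here asserts anything about [EtTh]'s curves.
-/

namespace Literature.AnabelianGeometry.EtaleTheta

namespace ThetaSubquotient

open scoped commutatorElement

universe u v w

variable {G : Type u} [Group G] {Q : Type v} [Group Q] {Λ : Type w} [CommGroup Λ] (q : G →* Q)
  (ι : Λ →* Q)

/-! ### The subgroup `J(S) = (q(S) ∩ L)·[L, q(S)]` to be killed at a stabiliser `S` -/

/-- `J(S) := (q(S) ⊓ L) ⊔ ⁅L, q(S)⁆ ⊆ Q`, `L := ι(Λ)`, for a subgroup `S ⊆ Π` (a stabiliser): the part of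
`L = l·Δ_Θ` invisible in `Aut` at an object with stabiliser `S` (`q(S) ∩ L`) together with what
conjugation by `q(S)` moves in `L`. [cite: MochizukiEtTh2009, §5 p.327 (PDF p.101)] -/
def killQ (S : Subgroup G) : Subgroup Q := (S.map q ⊓ ι.range) ⊔ ⁅ι.range, S.map q⁆

/-- `J(S) ⊆ L` (`L` normal). [cite: MochizukiEtTh2009, §5 p.327 (PDF p.101)] -/
theorem killQ_le [ι.range.Normal] (S : Subgroup G) : killQ q ι S ≤ ι.range :=
  sup_le inf_le_right (Subgroup.commutator_le_left _ _)

/-- `J` is monotone in the stabiliser. [cite: MochizukiEtTh2009, §5 p.327 (PDF p.101)] -/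
theorem killQ_mono {S S' : Subgroup G} (h : S ≤ S') : killQ q ι S ≤ killQ q ι S' :=
  sup_le_sup (inf_le_inf_right _ (Subgroup.map_mono h))
    (Subgroup.commutator_mono le_rfl (Subgroup.map_mono h))

/-- Elements of `q(S) ∩ L` die in `Λ/J(S)`. [cite: MochizukiEtTh2009, §5 p.327 (PDF p.101)] -/
theorem mem_killQ_of_mem_map {S : Subgroup G} {x : Q} (h₁ : x ∈ S.map q) (h₂ : x ∈ ι.range) :
    x ∈ killQ q ι S :=
  Subgroup.mem_sup_left ⟨h₁, h₂⟩

/-- **Conjugation by `q(S)` is trivial on `Λ/J(S)`**: `q(s)·l·q(s)⁻¹·l⁻¹ ∈ J(S)` for `l ∈ L`, `s ∈ S`.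
[cite: MochizukiEtTh2009, §5 p.327 (PDF p.101)] -/
theorem conj_mul_inv_mem_killQ {S : Subgroup G} {l : Q} (hl : l ∈ ι.range) {s : G} (hs : s ∈ S) :
    q s * l * (q s)⁻¹ * l⁻¹ ∈ killQ q ι S := by
  have h : ⁅(q s : Q), l⁆ ∈ ⁅S.map q, ι.range⁆ :=
    Subgroup.commutator_mem_commutator (Subgroup.mem_map_of_mem q hs) hl
  rw [Subgroup.commutator_comm, commutatorElement_def] at h
  exact Subgroup.mem_sup_right h

/-- **Conjugation equivariance**: if `g S g⁻¹ ⊆ S'` then `q(g) J(S) q(g)⁻¹ ⊆ J(S')` (`L` normal).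
[cite: MochizukiEtTh2009, §5 p.327 (PDF p.101)] -/
theorem conj_mem_killQ [hL : ι.range.Normal] {S S' : Subgroup G} {g : G}
    (hg : ∀ s ∈ S, g * s * g⁻¹ ∈ S') {x : Q} (hx : x ∈ killQ q ι S) :
    q g * x * (q g)⁻¹ ∈ killQ q ι S' := by
  have hS : (S.map q).map (MulAut.conj (q g)).toMonoidHom ≤ S'.map q := by
    rintro _ ⟨_, ⟨s, hs, rfl⟩, rfl⟩
    exact ⟨g * s * g⁻¹, hg s hs, by simp⟩
  have hLc : ι.range.map (MulAut.conj (q g)).toMonoidHom ≤ ι.range := by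
    rintro _ ⟨l, hl, rfl⟩
    exact hL.conj_mem l hl (q g)
  have key : (killQ q ι S).map (MulAut.conj (q g)).toMonoidHom ≤ killQ q ι S' := by
    unfold killQ
    rw [Subgroup.map_sup]
    refine sup_le_sup ?_ ?_
    · exact (Subgroup.map_inf_le _ _ _).trans (inf_le_inf hS hLc)
    · rw [Subgroup.map_commutator]
      exact Subgroup.commutator_mono hLc hS
  exact key ⟨x, hx, rfl⟩

/-- **Galois stabilisers**: if `q(S)` is normal in `Q` (e.g. `S` normal, `q` surjective) the commutator
term
is absorbed, `J(S) = q(S) ∩ L`, so `Λ/J(S) = L/(L ∩ q(S)) ≅ L·q(S)/q(S)` — print's subquotient of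
`Aut(Π/S) = Π/S ↠ Q/q(S)`. [cite: MochizukiEtTh2009, §5 p.327 (PDF p.101)] -/
theorem killQ_eq_of_normal [ι.range.Normal] {S : Subgroup G} [(S.map q).Normal] :
    killQ q ι S = S.map q ⊓ ι.range :=
  le_antisymm (sup_le le_rfl (le_inf (Subgroup.commutator_le_right _ _)
    (Subgroup.commutator_le_left _ _))) le_sup_left

/-! ### The carriers `Λ/J(S)` and the transport `Λ/J(S) ↠ Λ/J(S')` for `S ⊆ S'` -/

/-- `ι⁻¹J(S)` as a subgroup of `Λ`. [cite: MochizukiEtTh2009, §5 p.327 (PDF p.101)] -/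
abbrev kill (S : Subgroup G) : Subgroup Λ := (killQ q ι S).comap ι

/-- The carrier `Λ/ι⁻¹J(S)` of the theta subquotient at a stabiliser `S`, an abelian group.
[cite: MochizukiEtTh2009, §5 p.327 (PDF p.101)] -/
abbrev Carrier (S : Subgroup G) : Type w := Λ ⧸ kill q ι S

/-- The transport `Λ/J(S) → Λ/J(S')` for `S ⊆ S'` (a morphism of transitive `Π`-sets `Π/S → Π/S'`
exists iff, after conjugation, `S ⊆ S'`). [cite: MochizukiEtTh2009, Prop 5.5 proof p.328 (PDF p.102)] -/
def proj {S S' : Subgroup G} (h : S ≤ S') : Carrier q ι S →* Carrier q ι S' :=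
  QuotientGroup.map _ _ (MonoidHom.id Λ) fun x hx => by
    simpa [Subgroup.mem_comap] using killQ_mono q ι h hx

/-- `proj` on classes. [cite: MochizukiEtTh2009, Prop 5.5 proof p.328 (PDF p.102)] -/
@[simp] theorem proj_mk {S S' : Subgroup G} (h : S ≤ S') (l : Λ) :
    proj q ι h (QuotientGroup.mk l) = QuotientGroup.mk l := rfl

/-- The transport maps are surjective ("induce isomorphisms … `⊗ ℤ/Nℤ`", p.328: surjections between finite
groups of equal order). [cite: MochizukiEtTh2009, Prop 5.5 proof p.328 (PDF p.102)] -/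
theorem proj_surjective {S S' : Subgroup G} (h : S ≤ S') : Function.Surjective (proj q ι h) := by
  rintro ⟨l⟩
  exact ⟨QuotientGroup.mk l, rfl⟩

/-- `proj` is transitive. [cite: MochizukiEtTh2009, Prop 5.5 proof p.328 (PDF p.102)] -/
theorem proj_comp_proj {S S' S'' : Subgroup G} (h : S ≤ S') (h' : S' ≤ S'') :
    (proj q ι h').comp (proj q ι h) = proj q ι (h.trans h') :=
  MonoidHom.ext fun x => QuotientGroup.induction_on x fun l => by
    simp only [MonoidHom.comp_apply, proj_mk]

/-- `proj` along `le_rfl` is the identity. [cite: MochizukiEtTh2009, Prop 5.5 proof p.328 (PDF p.102)] -/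
theorem proj_refl (S : Subgroup G) : proj q ι (le_refl S) = MonoidHom.id _ :=
  MonoidHom.ext fun x => QuotientGroup.induction_on x fun l => by
    simp only [MonoidHom.id_apply, proj_mk]

/-! ### "`⊗ ℤ/Nℤ`": quotients by `N`-th powers and the equal-cardinality criterion -/

/-- `A ⊗ ℤ/Nℤ` for a multiplicatively written abelian group: the quotient by `N`-th powers (as in
abc-iut-L2-t4's `ThetaFrobenioid.lDeltaModN`). [cite: MochizukiEtTh2009, Def 5.4 p.327 (PDF p.101)] -/
abbrev ModPow (A : Type u) [CommGroup A] (N : ℕ) : Type u := A ⧸ (powMonoidHom N : A →* A).range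

/-- The map induced on `(−) ⊗ ℤ/Nℤ` by a homomorphism.
[cite: MochizukiEtTh2009, Prop 5.5 proof p.328 (PDF p.102)] -/
def modPowMap {A B : Type u} [CommGroup A] [CommGroup B] (f : A →* B) (N : ℕ) :
    ModPow A N →* ModPow B N :=
  QuotientGroup.map _ _ f (by
    rintro _ ⟨a, rfl⟩
    exact ⟨f a, by simp [map_pow]⟩)

/-- A surjection induces a surjection on `(−) ⊗ ℤ/Nℤ`.
[cite: MochizukiEtTh2009, Prop 5.5 proof p.328 (PDF p.102)] -/
theorem modPowMap_surjective {A B : Type u} [CommGroup A] [CommGroup B] {f : A →* B}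
    (hf : Function.Surjective f) (N : ℕ) : Function.Surjective (modPowMap f N) := by
  rintro ⟨b⟩
  obtain ⟨a, rfl⟩ := hf b
  exact ⟨QuotientGroup.mk a, rfl⟩

/-- **"induce isomorphisms … `⊗ ℤ/Nℤ`"** (p.328): a surjection between finite groups of the same
cardinality is bijective — with Def. 5.4 (b) ("`(l·Δ_Θ)_S ⊗ ℤ/Nℤ` is of cardinality `N`" at both ends) the
transport is an isomorphism. [cite: MochizukiEtTh2009, Prop 5.5 proof p.328 (PDF p.102)] -/
theorem modPowMap_bijective_of_card_eq {A B : Type u} [CommGroup A] [CommGroup B] {f : A →* B}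
    (hf : Function.Surjective f) (N : ℕ) [Finite (ModPow A N)]
    (hcard : Nat.card (ModPow A N) = Nat.card (ModPow B N)) : Function.Bijective (modPowMap f N) := by
  have hs := modPowMap_surjective hf N
  exact hs.bijective_of_nat_card_le hcard.le

end ThetaSubquotient

end Literature.AnabelianGeometry.EtaleTheta
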